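import Literature.NumberTheory.EllipticCurves.Kim2026.ShaLengthRankZeroLowerBound
import Summits.BirchSwinnertonDyer.Rank1Residual.Additive.X4RankZeroKuriharaWitness
import HarnessLib

/-!
# X4 ∧ `r_an = 0` at `p ≥ 5`: the level-`k` Kurihara certificate (Kim 2026 Thm. 1.8 (6) beyond the unit
# case) PLUGGED INTO additive-p4's output-shape sockets — `BSD(E,p)` on the potentially good
# Tamagawa-defect-ONE LOWER rows via sharp Kato + Cassels–Tate parity
# (cell `b2b-bsdres`, team n1011, row T-N10K, seat `b2b-bsdres-n1011-p11`; sequel of `X4/KuriharaLowerHalf.lean`)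

HONEST FRAMING (run/shared/lean/b2b/bsd-rank1-residual/, verbatim in every file): the goal of the
cell is to DELETE the COMBINATION-SHAPED residual classes of the Birch–Swinnerton-Dyer formula for
ALL analytic-rank `≤ 1` elliptic curves over `ℚ` — "full BSD formula for every rank `≤ 1` curve in
class `C`" assembled STRICTLY from published theorems — so that the rank-`≤ 1` remainder becomes
exactly the CONSTRUCTION-SHAPED classes, which are TYPED (missing-input `Prop`s), NOT attempted.
This is not "finishing BSD". Team n1011: prove what is provable now; shrink each hard class to its
core with data; no claim beyond stated classes. X4 stays CONSTRUCTION-SHAPED; the RESIDUAL-MAP marks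
of N10 / N11 are UNCHANGED; nothing booked. THEOREMS ONLY (no definition, no named fact minted);
PER PAIR (certificate shape), not a class theorem.

## What this file does

Additive-p4 GEN 16 (`Additive/X4RankZeroKuriharaWitness.lean`, p249363) built the fact-agnostic
SOCKET between the OUTPUT SHAPE of Kim's Kurihara-number theorems at a pair —
`L(E,1)/Ω(W) = q₀ ∧ ord_p q₀ − j ≤ ord_p #Ш(E/ℚ)(p)`, `j ≤ ord_p ∏ c_ℓ` — and the X4 residue partition
of record ("the day a Kurihara-number theorem … delivers the output shape at a pair, that LOWER row
is `BSD(E,p)` by composition with this file"). At `p ≥ 5` the PUBLISHED theorem now delivers it in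
the kernel: the named fact `Kim2026.rankZero_le_padicValNat_sha_of_kuriharaNumber_ne_zero` (this seat,
p249207; Kim AJM 148 (2026) Thm. 1.8 (6) beyond the unit case) turns ONE Kurihara number non-zero
modulo `p^k` at a level `n ∈ 𝒩_k` into the output shape with `j = k − 1`. This file composes:

* §1 `lOmegaWitness_of_kimLower` — the named fact's conclusion IS the socket's hypothesis
  (`ord_p q₀ ≤ ord_p #Ш(p) + (k − 1)` ⟺ `ord_p q₀ − (k − 1) ≤ ord_p #Ш(p)`); bookkeeping.
* §2 **`X4RankZero.bsdp_of_katoSharp_of_casselsTate_of_kimLower_of_even`** — X4 ∧ `r_an = 0` ∧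
  `p ≥ 5` ∧ surj(p) (tower by Serre) ∧ `ord_p j ≥ 0` (potentially GOOD, ordinary OR supersingular) ∧
  `ord_p ∏ c_ℓ ≤ 1` (at an additive `p ≥ 5`, `p ∤ c_p` by Kodaira–Néron, so this is additive-p4's
  `ord_p ∏ c_ℓ ≤ v_p(c_p) + 1`) ∧ `ord_p #Ш_an` even ∧ ONE Kurihara number of level `k ≤ ord_p ∏c_ℓ + 1`
  ⟹ `BSD(E,p)`, through additive-p4's parity socket
  `X4RankZero.bsdp_of_katoSharp_of_casselsTate_of_LOmegaWitness_of_even` (sharp Kato 14.5 (3) +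
  14.16 (2) reading `hKatoS` — flag `Kato-14.5(3)-14.16(2)-additive-potgood-reading-sharp`, ADMITTED at
  statement level, formal D-closure owed —, Cassels–Tate `hCT`, GZK, modularity).
* §3 `X4RankZero.bsdp_of_facts_of_kimLower_of_potMult_of_five_le` — the (M) branch of additive-p4's
  `X4RankZero.bsdp_of_facts_of_LOmegaWitness_of_five_le` fed by the certificate (same rows as
  `X4.ClassX4M.bsdp_rankZero_of_kimLower` of `X4/KuriharaLowerHalf.lean`, through the chain of record).

Census (this seat, `HOME/b2b-bsdres-n1011-p11/census/n10k_targets_p11.{py,json,md}` + SHA256SUMS; pure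
count, nothing booked): of the 21 S-b X4 ∧ r0 ∧ surj ∧ `p ≥ 5` LOWER rows with a Tamagawa defect (all
`ord_p ∏ c_ℓ = 1`, `#Ш_an = p²`), §2 makes the 11 potentially GOOD ones certificate-shaped (level-2
Kurihara number): (G-ord, `e = 2`) 301350ed1@5; (G-ord, `e ∈ {3,4,6}`) 76350ba1@5, 147150j1@5;
(G)∧ss 288600bn1@5; (t′) 121450d1, 126350do1, 302400ny1, 442200bc1, 492450fq1, 498675t1 @5,
270480dm1@7 — and §3 / `X4.ClassX4M.bsdp_rankZero_of_kimLower` the 10 (M) ones. No certificate is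
computed here (instrument I-12 at level `p²`: primes `ℓ ≡ 1`, `a_ℓ ≡ ℓ + 1 (mod p²)`); labels unchanged.

References: [Kim2022StructureSelmer] Thm. 1.9 (6), §1.5.1; [Kato2004Asterisque] Thm. 14.5 (3), Prop.
14.16 (2); [SilvermanAEC2009] Thm. X.4.14; [SilvermanATAEC1994] Cor. IV.9.2 (d); [Miller2011LMS] Def. 1.1.
-/

noncomputable section

open scoped Classical MatrixGroups ModularForm

open CongruenceSubgroup WeierstrassCurve Literature.NumberTheory.EllipticCurves
  Literature.NumberTheory.EllipticCurves.ModularForms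
  Literature.NumberTheory.EllipticCurves.Rank1Residual
  Literature.NumberTheory.EllipticCurves.Rank1Residual.Typed
  Summit.BirchSwinnertonDyer.Rank1Residual.Additive

namespace Summit.BirchSwinnertonDyer.Rank1Residual.X4

variable (W : WeierstrassCurve ℚ) [W.IsElliptic] [W.IsGloballyMinimal] (p : ℕ) [hp : Fact p.Prime]

/-! ### §1 The named fact's conclusion is the socket's hypothesis -/

/-- **The level-`k` Kurihara certificate delivers additive-p4's output shape** with `j = k − 1`:
`L(E,1)/Ω(W) = q₀ ∧ ord_p q₀ − (k − 1) ≤ ord_p #Ш(E/ℚ)(p)` (rank `0`, `p ≥ 5`, any reduction at `p`,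
`ρ̄_{E,p}` onto, Manin datum, period transfer, `n ∈ 𝒩_k` with cyclic reductions, `ψ ↠ ℤ/p^k`,
`δ̃_n^{(k)} ≠ 0`; Kim 2026 Thm. 1.8 (6) beyond the unit case `hKim`). Bookkeeping.
[cite: Kim2022StructureSelmer, Thm. 1.9 (6) (PDF p. 8) and §1.5.1 (PDF p. 7)] -/
theorem lOmegaWitness_of_kimLower
    (hKim : Kim2026.rankZero_le_padicValNat_sha_of_kuriharaNumber_ne_zero) (hp5 : 5 ≤ p)
    (hsurj : Surj W p) (hL : W.entireLFunction 1 ≠ 0) (hfin : Finite W.sha)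
    {N : ℕ} [NeZero N] (D : ModularParametrizationData W N) (hc : ¬ (p : ℤ) ∣ D.maninConstant)
    (hper : ∃ u : ℚ, ‖(u : ℚ_[p])‖ = 1 ∧ W.realPeriodRat = u * plusPeriod D.f)
    (k n : ℕ) [NeZero n] (hk : 1 ≤ k) (hn : Kato.IsKolyvaginProduct W p k n)
    (hcyc : ∀ (ℓ : ℕ) [Fact ℓ.Prime], ℓ ∣ n →
      Nat.card {P : ((WeierstrassCurve.integralModelInt W).map
          (Int.castRingHom (ZMod ℓ))).toAffine.Point // p • P = 0} ≤ p)
    (ψ : (ℓ : ℕ) → (ZMod ℓ)ˣ →* Multiplicative (ZMod (p ^ k)))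
    (hψ : ∀ ℓ ∈ n.primeFactors, Function.Surjective (ψ ℓ))
    (hδ : kuriharaNumber D.f (p ^ k) n ψ ≠ 0) :
    ∃ q₀ : ℚ, W.entireLFunction 1 / (W.realPeriodRat : ℂ) = (q₀ : ℂ) ∧
      padicValRat p q₀ - ((k - 1 : ℕ) : ℤ) ≤
        (padicValNat p (Nat.card (AddCommGroup.primaryComponent W.sha p)) : ℤ) := by
  obtain ⟨q₀, hq₀, hv⟩ := hKim W p hp5 hsurj hL hfin D hc hper k n hk hn hcyc ψ hψ hδ
  exact ⟨q₀, hq₀, by linarith⟩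

/-! ### §2 Potentially good Tamagawa-defect-ONE rows: sharp Kato + Cassels–Tate parity + the certificate -/

/-- **X4 ∧ `r_an = 0` ∧ `p ≥ 5` ∧ surj(p) ∧ potentially GOOD ∧ `ord_p ∏ c_ℓ ≤ 1` ∧ `ord_p #Ш_an` even:
`BSD(E,p)` from ONE Kurihara number of level `k ≤ ord_p ∏ c_ℓ + 1`.** Inputs: sharp Kato reading
`hKatoS` (flag `Kato-14.5(3)-14.16(2)-additive-potgood-reading-sharp`, admitted at statement level),
Cassels–Tate `hCT`, GZK `hGZK`, modularity `hmod`, Kim 2026 Thm. 1.8 (6) beyond the unit case `hKim`;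
the tower `ρ̄_{E,p^n}` onto ∀ `n` is Serre's at `p ≥ 5`; `p ∤ c_p` at an additive `p ≥ 5`
(Kodaira–Néron, `padicValNat_localTamagawaNumber_padic_eq_zero_of_addv`) turns `ord_p ∏ c_ℓ ≤ 1` into
additive-p4's `ord_p ∏ c_ℓ ≤ v_p(c_p) + 1`; composition with
`X4RankZero.bsdp_of_katoSharp_of_casselsTate_of_LOmegaWitness_of_even`. Census: the 11 potentially
good S-b LOWER rows at `p ≥ 5` with `ord_p ∏ c_ℓ = 1` (`#Ш_an = p²`). Per pair; nothing booked.
[cite: Kato2004Asterisque, Thm. 14.5 (3) (p. 236), Prop. 14.16 (2) (p. 244)] [cite: SilvermanAEC2009, Thm. X.4.14]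
[cite: Kim2022StructureSelmer, Thm. 1.9 (6) (PDF p. 8)] [cite: Miller2011LMS, Def. 1.1] -/
theorem X4RankZero.bsdp_of_katoSharp_of_casselsTate_of_kimLower_of_even
    (hKim : Kim2026.rankZero_le_padicValNat_sha_of_kuriharaNumber_ne_zero)
    (hCT : exists_casselsTate_pairing (K := ℚ))
    (hKatoS : Kato2004.rankZero_padicValNat_sha_le_sub_localTamagawa_of_additive_potGood_of_imageContainsSL2)
    (hGZK : rank_eq_analyticRank_of_analyticRank_le_one) (hmod : hasEntireLFunction_rat)
    (hp5 : 5 ≤ p) (hr : W.analyticRank = 0) (hX : ClassX4 W p) (hsurj : Surj W p)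
    (hpot : 0 ≤ padicValRat p W.j) (htam : padicValNat p W.tamagawaProduct ≤ 1)
    {q : ℚ} (hq : shaAn W = (q : ℂ)) (heven : Even (padicValRat p q))
    {N : ℕ} [NeZero N] (D : ModularParametrizationData W N) (hc : ¬ (p : ℤ) ∣ D.maninConstant)
    (hper : ∃ u : ℚ, ‖(u : ℚ_[p])‖ = 1 ∧ W.realPeriodRat = u * plusPeriod D.f)
    (k n : ℕ) [NeZero n] (hk : 1 ≤ k) (hkt : k ≤ padicValNat p W.tamagawaProduct + 1)
    (hn : Kato.IsKolyvaginProduct W p k n)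
    (hcyc : ∀ (ℓ : ℕ) [Fact ℓ.Prime], ℓ ∣ n →
      Nat.card {P : ((WeierstrassCurve.integralModelInt W).map
          (Int.castRingHom (ZMod ℓ))).toAffine.Point // p • P = 0} ≤ p)
    (ψ : (ℓ : ℕ) → (ZMod ℓ)ˣ →* Multiplicative (ZMod (p ^ k)))
    (hψ : ∀ ℓ ∈ n.primeFactors, Function.Surjective (ψ ℓ))
    (hδ : kuriharaNumber D.f (p ^ k) n ψ ≠ 0) : BSDp W p := by
  have hL : W.entireLFunction 1 ≠ 0 := by
    rw [← W.leadingLCoeff_eq_of_analyticRank_eq_zero hr]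
    exact W.leadingLCoeff_ne_zero_holds (hmod W)
  have hfin : Finite W.sha := (hGZK W (by rw [hr]; exact zero_le_one)).2
  have htower : ∀ m : ℕ, W.HasSurjectiveModNGaloisRep (p ^ m : ℕ) :=
    serre_hasSurjectiveModNGaloisRep_pow_holds W p hp5 hsurj
  have hdef : padicValNat p W.tamagawaProduct ≤
      padicValNat p ((W.baseChange ℚ_[p]).localTamagawaNumber ℤ_[p]) + 1 := by
    rw [padicValNat_localTamagawaNumber_padic_eq_zero_of_addv W p hX.2.1 hp5]; simpa using htam
  obtain ⟨q₀, hq₀, hw⟩ := lOmegaWitness_of_kimLower W p hKim hp5 hsurj hL hfin D hc hper k n hk hn hcyc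
    ψ hψ hδ
  have hj : k - 1 ≤ padicValNat p W.tamagawaProduct := by omega
  exact X4RankZero.bsdp_of_katoSharp_of_casselsTate_of_LOmegaWitness_of_even W p hCT hKatoS hGZK hmod
    hr hX hpot htower D hc hdef hq heven hq₀ hj hw

/-! ### §3 The (M) branch of additive-p4's `p ≥ 5` socket, fed by the certificate -/

/-- **X4(M) ∧ `r_an = 0` ∧ `p ≥ 5` ∧ surj(p): `BSD(E,p)` from ONE Kurihara number of level
`k ≤ ord_p ∏ c_ℓ + 1`, through additive-p4's chain of record** (`X4RankZero.bsdp_of_facts_of_LOmegaWitness_of_five_le`,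
(M) branch `ord_p j < 0`: sharp Kato `hKatoS` is idle there, Delbourgo Prop. 4 `hDel`, Wuthrich
Lemma 20 `hL20` / Kato half-eigen `hKatoχ`, `hmodD`, GZK, modularity) and Kim `hKim`. Same rows as
`X4.ClassX4M.bsdp_rankZero_of_kimLower` (`X4/KuriharaLowerHalf.lean`, additive-p1's chain); recorded for
the partition of record. Per pair; nothing booked. [cite: Delbourgo1998, Prop. 4 (p. 144)]
[cite: Wuthrich2014, Lemma 20 (p. 399), Cor. 19 (p. 398)] [cite: Kim2022StructureSelmer, Thm. 1.9 (6) (PDF p. 8)]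
[cite: Miller2011LMS, Def. 1.1] -/
theorem X4RankZero.bsdp_of_facts_of_kimLower_of_potMult_of_five_le
    (hKim : Kim2026.rankZero_le_padicValNat_sha_of_kuriharaNumber_ne_zero)
    (hKatoS : Kato2004.rankZero_padicValNat_sha_le_sub_localTamagawa_of_additive_potGood_of_imageContainsSL2)
    (hDel : Delbourgo1998.prop4_rankZero_pow_dvd_constantCoeff)
    (hGZK : rank_eq_analyticRank_of_analyticRank_le_one) (hmod : hasEntireLFunction_rat)
    (hmodD : nonempty_modularParametrizationData)
    (hL20 : Wuthrich2014.lemma20_surjective_threeAdic_of_semistable)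
    (hKatoχ : Wuthrich2014.kato_halfEigenCharIdeal_dvd_cyclotomicPrime_of_surjective)
    (hp5 : 5 ≤ p) (hr : W.analyticRank = 0) (hX : ClassX4 W p) (hsurj : Surj W p)
    (hM : padicValRat p W.j < 0)
    {N : ℕ} [NeZero N] (D : ModularParametrizationData W N) (hc : ¬ (p : ℤ) ∣ D.maninConstant)
    (hper : ∃ u : ℚ, ‖(u : ℚ_[p])‖ = 1 ∧ W.realPeriodRat = u * plusPeriod D.f)
    (k n : ℕ) [NeZero n] (hk : 1 ≤ k) (hkt : k ≤ padicValNat p W.tamagawaProduct + 1)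
    (hn : Kato.IsKolyvaginProduct W p k n)
    (hcyc : ∀ (ℓ : ℕ) [Fact ℓ.Prime], ℓ ∣ n →
      Nat.card {P : ((WeierstrassCurve.integralModelInt W).map
          (Int.castRingHom (ZMod ℓ))).toAffine.Point // p • P = 0} ≤ p)
    (ψ : (ℓ : ℕ) → (ZMod ℓ)ˣ →* Multiplicative (ZMod (p ^ k)))
    (hψ : ∀ ℓ ∈ n.primeFactors, Function.Surjective (ψ ℓ))
    (hδ : kuriharaNumber D.f (p ^ k) n ψ ≠ 0) : BSDp W p := by
  have hL : W.entireLFunction 1 ≠ 0 := by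
    rw [← W.leadingLCoeff_eq_of_analyticRank_eq_zero hr]
    exact W.leadingLCoeff_ne_zero_holds (hmod W)
  have hfin : Finite W.sha := (hGZK W (by rw [hr]; exact zero_le_one)).2
  obtain ⟨q₀, hq₀, hw⟩ := lOmegaWitness_of_kimLower W p hKim hp5 hsurj hL hfin D hc hper k n hk hn hcyc
    ψ hψ hδ
  have hj : k - 1 ≤ padicValNat p W.tamagawaProduct := by omega
  exact X4RankZero.bsdp_of_facts_of_LOmegaWitness_of_five_le W p hKatoS hDel hGZK hmod hmodD hL20 hKatoχ
    hp5 hr hX hsurj (Or.inl hM) hq₀ hj hw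

end Summit.BirchSwinnertonDyer.Rank1Residual.X4

end
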